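import Summits.ValiantsHypothesis.ValiantsHypothesis.Theorems.DepthWindowTwoLetterRegroup
import Summits.ValiantsHypothesis.ValiantsHypothesis.Theorems.DepthWindowTwoLetterEuclid

/-!
# Route `DepthWindow` — the two-letter builder: one round

Cone-free support (decomp-valiant lens 4, g15; critic-675 NEXT (b)) for the crux item `HomImmHardTwoOne`
(stmt-ValiantsHypothesis-30635): the ROUND of the universal two-letter low-bias-tree builder whose iteration
(`DepthWindowTwoLetterULB`) proves `ULB₂` for two-valued words.

Letters `-t` (×A) and `+s` (×B), `1 ≤ s ≤ t ≤ h`.  A STATE is `(i, A, B)`: `A` blocks of the convergent type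
`τ_i` and `B` of type `τ_{i+1}` (values `e_i`, `e_{i+1}` of opposite signs, `DepthWindowTwoLetterEuclid`),
balanced (`|A e_i + B e_{i+1}| ≤ h`) with exponents `(p, p')`: `ρ_{i+1} 2^p ≤ h`, `ρ_i 2^{p'} ≤ h`.
A ROUND (`round_step`) jumps in ONE tree level to the farthest affordable type `τ_{i+N}` (node mass
`cost ≤ 6h`), re-expressing the counts exactly along the count chain (`(A, B) ↦ (B - aA, A)`, unimodular,
`DepthWindowTwoLetterEuclid.chain_consume`); if the chain breaks (too few small blocks) the round is a
semiconvergent split into same-sign blocks and the next level is the root (outcome FINISHED); if it completes,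
the jump estimate `progress` gives `2h·ρ_new ≤ ρ_i ρ_{i+1}`, so the exponents evolve by
`(p, p') ↦ (p + p' + 1, p)` (outcome: a new admissible STATE).

References: [LimayeSrinivasanTavenas2022] full version §1.2 Question 1, Prop. 17; [BhargavDuttaSaxena2024] §5
(designed two-letter families, continued fractions); the universal builder is the workshop's (NODE-v15).
-/

-- layout Summits/ValiantsHypothesis/ValiantsHypothesis forces the duplicated namespace component
set_option linter.dupNamespace false

namespace Summit.ValiantsHypothesis.ValiantsHypothesis.Theorems.DepthWindow.TreeBias

open Finset Literature.Computability.AlgebraicComplexity TwoLetter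

section Builder

variable {t s h : ℕ}

/-- `cost i 2 = ρ_i + a_i ρ_{i+1} ≤ 2ρ_i`: the first jump is always affordable. [folklore] -/
theorem cost_two_le (i : ℕ) : cost t s i 2 ≤ 2 * rho t s i := by
  have h2 := cost_add_two t s i 0
  simp only [Nat.add_zero, zero_add, cost_one, cost_zero] at h2
  have := quo_mul_le t s i
  rw [h2]; omega

/-- Greatest index `M ∈ [m₀, n]` of a predicate holding at `m₀`, with the maximality alternative spelled out.
[folklore] -/
theorem exists_greatest_of_base (P : ℕ → Prop) {m₀ n : ℕ} (hm₀ : m₀ ≤ n) (h0 : P m₀) :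
    ∃ M, m₀ ≤ M ∧ M ≤ n ∧ P M ∧ (M = n ∨ (M < n ∧ ¬ P (M + 1))) := by
  classical
  refine ⟨Nat.findGreatest P n, Nat.le_findGreatest hm₀ h0, Nat.findGreatest_le n,
    Nat.findGreatest_spec hm₀ h0, ?_⟩
  by_cases h : Nat.findGreatest P n = n
  · exact Or.inl h
  · have hlt : Nat.findGreatest P n < n := lt_of_le_of_ne (Nat.findGreatest_le n) h
    exact Or.inr ⟨hlt, Nat.findGreatest_is_greatest (Nat.lt_succ_self _) hlt⟩

/-- **The round, given the target.**  From the state `(i, A, B)` with target offset `K + 2` (all types up to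
`τ_{i+K+2}` affordable; either `ρ_{i+K+2} = 0` or `τ_{i+K+3}` is unaffordable with positive remainders up to
`i+K+2`): one tree level leads either to a FINISHED word (same-sign letters, balanced) or to a new admissible
state whose exponents made the Fibonacci step `(p, p') ↦ (p + p' + 1, p)`; the state outcome also records the
count bookkeeping (`A, B` in terms of the new counts and the continuants, and the unaffordability of the next type)
for the `d`-form of the depth bound. [cite: LimayeSrinivasanTavenas2022, Prop. 16] -/
theorem round_core (hh : 1 ≤ h) {i A B p p' : ℕ} (K : ℕ)
    (hpos : ∀ m ≤ i + 1, 0 < rho t s m) (hdec : rho t s (i + 1) ≤ rho t s i)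
    (hbal : |(A : ℤ) * ev t s i + (B : ℤ) * ev t s (i + 1)| ≤ h)
    (hp : rho t s (i + 1) * 2 ^ p ≤ h) (hp' : rho t s i * 2 ^ p' ≤ h)
    (hF1 : ∀ m ≤ K + 2, cost t s i m ≤ 6 * h)
    (hF4 : rho t s (i + (K + 2)) = 0 ∨ (6 * h < cost t s i (K + 3) ∧ ∀ m ≤ K + 2, 0 < rho t s (i + m))) :
    ∃ (A₁ B₁ : ℕ) (X₁ Y₁ : ℤ),
      (∀ Δ, LowBiasTree (twoWord A₁ B₁ X₁ Y₁) Δ ((6 * h : ℕ) : ℤ) →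
          LowBiasTree (twoWord A B (ev t s i) (ev t s (i + 1))) (Δ + 1) ((6 * h : ℕ) : ℤ)) ∧
      ((∀ Δ, 1 ≤ Δ → LowBiasTree (twoWord A₁ B₁ X₁ Y₁) Δ ((6 * h : ℕ) : ℤ)) ∨
       (∃ i₁, X₁ = ev t s i₁ ∧ Y₁ = ev t s (i₁ + 1) ∧ 1 ≤ A₁ ∧ 1 ≤ B₁ ∧ (∀ m ≤ i₁ + 1, 0 < rho t s m) ∧
          rho t s (i₁ + 1) ≤ rho t s i₁ ∧ |(A₁ : ℤ) * ev t s i₁ + (B₁ : ℤ) * ev t s (i₁ + 1)| ≤ h ∧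
          rho t s (i₁ + 1) * 2 ^ (p + p' + 1) ≤ h ∧ rho t s i₁ * 2 ^ p ≤ h ∧
          ∃ N, i₁ = i + (N + 1) ∧ A = A₁ * cfL t s i (N + 1) + B₁ * cfL t s i (N + 2) ∧
            B = A₁ * cfR t s i (N + 1) + B₁ * cfR t s i (N + 2) ∧ 6 * h < cost t s i (N + 3))) := by
  classical
  have h6 : (h : ℤ) ≤ ((6 * h : ℕ) : ℤ) := by push_cast; linarith
  -- the count chain, run as far as it stays valid (at most to offset K + 1)
  obtain ⟨M, -, hMle, hVM, hMax⟩ := exists_greatest_of_base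
    (fun m => ∀ m' < m, quo t s (i + m') * (chain t s i A B m').1 ≤ (chain t s i A B m').2)
    (Nat.zero_le (K + 1)) (fun m' hm' => absurd hm' (Nat.not_lt_zero _))
  rcases hMax with hMa | ⟨hMlt, hnV⟩
  · ----------------------------------------------------------------- case (a): the chain reaches the target
    subst hMa
    have hVK := hVM
    obtain ⟨hcA, hcB⟩ := chain_consume t s i A B (K + 1) hVK
    have hbal' := chain_balance t s i A B (K + 1) hVK
    generalize hC1 : (chain t s i A B (K + 1)).1 = C₁ at hcA hcB hbal'
    generalize hC2 : (chain t s i A B (K + 1)).2 = C₂ at hcA hcB hbal'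
    have e1 := ev_base t s i (K + 1)
    have e2 := ev_base t s i (K + 2)
    have hlift : ∀ Δ, LowBiasTree (twoWord C₁ C₂ (ev t s (i + (K + 1))) (ev t s (i + (K + 2)))) Δ
        ((6 * h : ℕ) : ℤ) → LowBiasTree (twoWord A B (ev t s i) (ev t s (i + 1))) (Δ + 1) ((6 * h : ℕ) : ℤ) := by
      intro Δ hT
      refine lowBiasTree_regroup hcA hcB (one_le_cfL_add_cfR t s i _) (one_le_cfL_add_cfR t s i _) ?_ ?_ ?_
      · rw [abs_ev, abs_ev]
        have := hF1 (K + 1) (by omega); unfold cost at this; exact_mod_cast this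
      · rw [abs_ev, abs_ev]
        have := hF1 (K + 2) le_rfl; unfold cost at this; exact_mod_cast this
      · rw [← e1, show K + 1 + 1 = K + 2 from rfl, ← e2]; exact hT
    have hS : (C₁ : ℤ) * ev t s (i + (K + 1)) + (C₂ : ℤ) * ev t s (i + (K + 2)) =
        (A : ℤ) * ev t s i + (B : ℤ) * ev t s (i + 1) := hbal'
    refine ⟨C₁, C₂, ev t s (i + (K + 1)), ev t s (i + (K + 2)), hlift, ?_⟩
    -- finish if the new second value vanishes, or one count is zero
    by_cases hz : rho t s (i + (K + 2)) = 0
    · left; intro Δ hΔ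
      have hY : ev t s (i + (K + 2)) = 0 := by simp [ev, hz]
      rw [hY]
      refine lowBiasTree_twoWord_of_sameSign ?_ ?_ hΔ
      · rcases le_total 0 (ev t s (i + (K + 1))) with hx | hx
        · exact Or.inl ⟨hx, le_rfl⟩
        · exact Or.inr ⟨hx, le_rfl⟩
      · rw [hY] at hS; rw [hS]; exact hbal.trans h6
    by_cases hC1z : C₁ = 0
    · left; intro Δ hΔ
      subst hC1z
      have hw : twoWord 0 C₂ (ev t s (i + (K + 1))) (ev t s (i + (K + 2))) =
          twoWord 0 C₂ (ev t s (i + (K + 2))) (ev t s (i + (K + 2))) := by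
        funext k; simp [twoWord]
      rw [hw]
      refine lowBiasTree_twoWord_of_sameSign ?_ ?_ hΔ
      · rcases le_total 0 (ev t s (i + (K + 2))) with hx | hx
        · exact Or.inl ⟨hx, hx⟩
        · exact Or.inr ⟨hx, hx⟩
      · have : (((0 : ℕ) : ℤ)) * ev t s (i + (K + 2)) + (C₂ : ℤ) * ev t s (i + (K + 2)) =
            (A : ℤ) * ev t s i + (B : ℤ) * ev t s (i + 1) := by rw [← hS]; push_cast; ring
        rw [this]; exact hbal.trans h6
    by_cases hC2z : C₂ = 0
    · left; intro Δ hΔ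
      subst hC2z
      have hw : twoWord C₁ 0 (ev t s (i + (K + 1))) (ev t s (i + (K + 2))) =
          twoWord C₁ 0 (ev t s (i + (K + 1))) (ev t s (i + (K + 1))) := by
        funext k
        have hk : (k : ℕ) < C₁ := by have := k.isLt; omega
        simp [twoWord, hk]
      rw [hw]
      refine lowBiasTree_twoWord_of_sameSign ?_ ?_ hΔ
      · rcases le_total 0 (ev t s (i + (K + 1))) with hx | hx
        · exact Or.inl ⟨hx, hx⟩
        · exact Or.inr ⟨hx, hx⟩
      · have : (C₁ : ℤ) * ev t s (i + (K + 1)) + (((0 : ℕ) : ℤ)) * ev t s (i + (K + 1)) =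
            (A : ℤ) * ev t s i + (B : ℤ) * ev t s (i + 1) := by rw [← hS]; push_cast; ring
        rw [this]; exact hbal.trans h6
    -- progress
    right
    rcases hF4 with hz' | ⟨hcost, hposN⟩
    · exact absurd hz' hz
    have hi2 : 0 < rho t s (i + 2) := hposN 2 (by omega)
    have ha : 1 ≤ quo t s (i + 1) := one_le_quo t s (i + 1) hi2 (rho_add_two_lt t s i (hpos (i + 1) le_rfl)).le
    have hprog := progress t s i (K + 2) (6 * h) hdec ha (by omega) hcost
    refine ⟨i + (K + 1), rfl, rfl, Nat.pos_of_ne_zero hC1z, Nat.pos_of_ne_zero hC2z, ?_, ?_, ?_, ?_, ?_,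
      K, rfl, hcA, hcB, hcost⟩
    · intro m hm
      by_cases hmi : m ≤ i + 1
      · exact hpos m hmi
      · have := hposN (m - i) (by omega); rwa [show i + (m - i) = m by omega] at this
    · exact rho_succ_le t s (i + (K + 1)) (by omega) (hposN (K + 1) (by omega))
    · rw [hbal']; exact hbal
    · -- the Fibonacci step of the exponents
      have h1 : 2 * h * rho t s (i + (K + 2)) ≤ rho t s i * rho t s (i + 1) := by
        have h3 : 3 * (2 * h * rho t s (i + (K + 2))) ≤ 3 * (rho t s i * rho t s (i + 1)) :=
          calc 3 * (2 * h * rho t s (i + (K + 2))) = 6 * h * rho t s (i + (K + 2)) := by ring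
            _ ≤ 3 * rho t s i * rho t s (i + 1) := hprog
            _ = 3 * (rho t s i * rho t s (i + 1)) := by ring
        exact Nat.le_of_mul_le_mul_left h3 (by norm_num)
      have h2 : h * (rho t s (i + (K + 2)) * 2 ^ (p + p' + 1)) ≤ h * h :=
        calc h * (rho t s (i + (K + 2)) * 2 ^ (p + p' + 1))
            = (2 * h * rho t s (i + (K + 2))) * (2 ^ p' * 2 ^ p) := by rw [pow_succ, pow_add]; ring
          _ ≤ (rho t s i * rho t s (i + 1)) * (2 ^ p' * 2 ^ p) := Nat.mul_le_mul_right _ h1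
          _ = (rho t s i * 2 ^ p') * (rho t s (i + 1) * 2 ^ p) := by ring
          _ ≤ h * h := Nat.mul_le_mul hp' hp
      exact Nat.le_of_mul_le_mul_left h2 hh
    · have hle : rho t s (i + (K + 1)) ≤ rho t s (i + 1) := by
        have := rho_add_le t s (j := i + 1) (by omega) K fun m hm => by
          have := hposN (m + 1) (by omega); rwa [show i + (m + 1) = i + 1 + m by omega] at this
        rw [show i + 1 + K = i + (K + 1) by omega] at this; omega
      exact le_trans (Nat.mul_le_mul_right _ hle) hp
  · ----------------------------------------------------------------- case (b): the chain breaks at M < K + 1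
    have hviol : (chain t s i A B M).2 < quo t s (i + M) * (chain t s i A B M).1 := by
      by_contra hcon
      push Not at hcon
      exact hnV fun m' hm' => (Nat.lt_succ_iff_lt_or_eq.1 hm').elim (hVM m') (fun he => he ▸ hcon)
    obtain ⟨hcA, hcB⟩ := chain_consume t s i A B M hVM
    have hbal' := chain_balance t s i A B M hVM
    have hqle := quo_mul_le t s (i + M)
    have hc2 := cost_add_two t s i M
    generalize ha : quo t s (i + M) = a at hviol hqle hc2
    generalize hC1 : (chain t s i A B M).1 = C₁ at hcA hcB hbal' hviol
    generalize hC2 : (chain t s i A B M).2 = C₂ at hcA hcB hbal' hviol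
    have hC1pos : 0 < C₁ := Nat.pos_of_ne_zero (by rintro rfl; simp at hviol)
    set q := C₂ / C₁ with hq
    set r := C₂ % C₁ with hr
    have hqr : C₁ * q + r = C₂ := Nat.div_add_mod C₂ C₁
    have hrlt : r < C₁ := Nat.mod_lt _ hC1pos
    have hqa : q < a := Nat.div_lt_of_lt_mul (by rwa [Nat.mul_comm] at hviol)
    obtain ⟨u, hu⟩ : ∃ u, C₁ = r + u := ⟨C₁ - r, by omega⟩
    -- the two block compositions U = τ_{i+M} + q τ_{i+M+1}, U₊ = τ_{i+M} + (q+1) τ_{i+M+1}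
    have hA' : A = u * (cfL t s i M + q * cfL t s i (M + 1)) + r * (cfL t s i M + (q + 1) * cfL t s i (M + 1)) := by
      rw [hcA, ← hqr, hu]; ring
    have hB' : B = u * (cfR t s i M + q * cfR t s i (M + 1)) + r * (cfR t s i M + (q + 1) * cfR t s i (M + 1)) := by
      rw [hcB, ← hqr, hu]; ring
    have hmass2 : (cfL t s i M + (q + 1) * cfL t s i (M + 1)) * rho t s i +
        (cfR t s i M + (q + 1) * cfR t s i (M + 1)) * rho t s (i + 1) ≤ 6 * h := by
      have hF := hF1 (M + 2) (by omega)
      rw [hc2] at hF; unfold cost at hF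
      have hq1 : q + 1 ≤ a := hqa
      have hP := Nat.mul_le_mul_right (cfL t s i (M + 1) * rho t s i + cfR t s i (M + 1) * rho t s (i + 1)) hq1
      calc (cfL t s i M + (q + 1) * cfL t s i (M + 1)) * rho t s i +
            (cfR t s i M + (q + 1) * cfR t s i (M + 1)) * rho t s (i + 1)
          = (cfL t s i M * rho t s i + cfR t s i M * rho t s (i + 1)) +
              (q + 1) * (cfL t s i (M + 1) * rho t s i + cfR t s i (M + 1) * rho t s (i + 1)) := by ring
        _ ≤ (cfL t s i M * rho t s i + cfR t s i M * rho t s (i + 1)) +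
              a * (cfL t s i (M + 1) * rho t s i + cfR t s i (M + 1) * rho t s (i + 1)) :=
            Nat.add_le_add_left hP _
        _ ≤ 6 * h := by rw [Nat.add_comm]; exact hF
    have hmass1 : (cfL t s i M + q * cfL t s i (M + 1)) * rho t s i +
        (cfR t s i M + q * cfR t s i (M + 1)) * rho t s (i + 1) ≤ 6 * h :=
      le_trans (Nat.add_le_add
        (Nat.mul_le_mul_right _ (Nat.add_le_add_left (Nat.mul_le_mul_right _ (Nat.le_succ q)) _))
        (Nat.mul_le_mul_right _ (Nat.add_le_add_left (Nat.mul_le_mul_right _ (Nat.le_succ q)) _))) hmass2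
    -- the new values and their common sign
    have hX : ((cfL t s i M + q * cfL t s i (M + 1) : ℕ) : ℤ) * ev t s i +
        ((cfR t s i M + q * cfR t s i (M + 1) : ℕ) : ℤ) * ev t s (i + 1) =
        (-1) ^ (i + M + 1) * ((rho t s (i + M) : ℤ) - q * rho t s (i + M + 1)) := by
      have eM := ev_base t s i M
      have eM1 := ev_base t s i (M + 1)
      rw [show i + (M + 1) = i + M + 1 by omega] at eM1
      have : ((cfL t s i M + q * cfL t s i (M + 1) : ℕ) : ℤ) * ev t s i +
          ((cfR t s i M + q * cfR t s i (M + 1) : ℕ) : ℤ) * ev t s (i + 1) =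
          ev t s (i + M) + q * ev t s (i + M + 1) := by rw [eM, eM1]; push_cast; ring
      rw [this]; simp only [ev]; ring
    have hY : ((cfL t s i M + (q + 1) * cfL t s i (M + 1) : ℕ) : ℤ) * ev t s i +
        ((cfR t s i M + (q + 1) * cfR t s i (M + 1) : ℕ) : ℤ) * ev t s (i + 1) =
        (-1) ^ (i + M + 1) * ((rho t s (i + M) : ℤ) - (q + 1) * rho t s (i + M + 1)) := by
      have eM := ev_base t s i M
      have eM1 := ev_base t s i (M + 1)
      rw [show i + (M + 1) = i + M + 1 by omega] at eM1
      have : ((cfL t s i M + (q + 1) * cfL t s i (M + 1) : ℕ) : ℤ) * ev t s i +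
          ((cfR t s i M + (q + 1) * cfR t s i (M + 1) : ℕ) : ℤ) * ev t s (i + 1) =
          ev t s (i + M) + (q + 1) * ev t s (i + M + 1) := by rw [eM, eM1]; push_cast; ring
      rw [this]; simp only [ev]; ring
    have hD1 : (q : ℤ) * rho t s (i + M + 1) ≤ rho t s (i + M) := by
      have : q * rho t s (i + M + 1) ≤ a * rho t s (i + M + 1) := Nat.mul_le_mul_right _ hqa.le
      exact_mod_cast this.trans hqle
    have hD2 : ((q : ℤ) + 1) * rho t s (i + M + 1) ≤ rho t s (i + M) := by
      have : (q + 1) * rho t s (i + M + 1) ≤ a * rho t s (i + M + 1) := Nat.mul_le_mul_right _ hqa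
      exact_mod_cast this.trans hqle
    refine ⟨u, r, _, _, fun Δ hT => lowBiasTree_regroup hA' hB' ?_ ?_ ?_ ?_ hT, Or.inl fun Δ hΔ => ?_⟩
    · have := one_le_cfL_add_cfR t s i M; omega
    · have := one_le_cfL_add_cfR t s i M; omega
    · rw [abs_ev, abs_ev]; exact_mod_cast hmass1
    · rw [abs_ev, abs_ev]; exact_mod_cast hmass2
    · rw [hX, hY]
      refine lowBiasTree_twoWord_of_sameSign ?_ ?_ hΔ
      · rcases neg_one_pow_eq_or ℤ (i + M + 1) with hσ | hσ <;> rw [hσ]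
        · left; constructor <;> linarith
        · right; constructor <;> linarith
      · have hS : (u : ℤ) * ((-1) ^ (i + M + 1) * ((rho t s (i + M) : ℤ) - q * rho t s (i + M + 1))) +
            (r : ℤ) * ((-1) ^ (i + M + 1) * ((rho t s (i + M) : ℤ) - (q + 1) * rho t s (i + M + 1))) =
            (A : ℤ) * ev t s i + (B : ℤ) * ev t s (i + 1) := by
          rw [← hbal']
          have hC1' : (C₁ : ℤ) = r + u := by exact_mod_cast hu
          have hC2' : (C₂ : ℤ) = C₁ * q + r := by exact_mod_cast hqr.symm
          rw [hC2', hC1']; simp only [ev]; ring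
        rw [hS]; exact hbal.trans h6

/-- **One round of the builder** from an admissible state `(i, A, B)` with exponents `(p, p')`: one tree level
leads either to a finished word or to an admissible state with exponents `(p + p' + 1, p)`.
[cite: LimayeSrinivasanTavenas2022, Prop. 16] -/
theorem round_step (hs1 : 1 ≤ s) (hst : s ≤ t) (hth : t ≤ h) {i A B p p' : ℕ}
    (hpos : ∀ m ≤ i + 1, 0 < rho t s m) (hdec : rho t s (i + 1) ≤ rho t s i)
    (hbal : |(A : ℤ) * ev t s i + (B : ℤ) * ev t s (i + 1)| ≤ h)
    (hp : rho t s (i + 1) * 2 ^ p ≤ h) (hp' : rho t s i * 2 ^ p' ≤ h) :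
    ∃ (A₁ B₁ : ℕ) (X₁ Y₁ : ℤ),
      (∀ Δ, LowBiasTree (twoWord A₁ B₁ X₁ Y₁) Δ ((6 * h : ℕ) : ℤ) →
          LowBiasTree (twoWord A B (ev t s i) (ev t s (i + 1))) (Δ + 1) ((6 * h : ℕ) : ℤ)) ∧
      ((∀ Δ, 1 ≤ Δ → LowBiasTree (twoWord A₁ B₁ X₁ Y₁) Δ ((6 * h : ℕ) : ℤ)) ∨
       (∃ i₁, X₁ = ev t s i₁ ∧ Y₁ = ev t s (i₁ + 1) ∧ 1 ≤ A₁ ∧ 1 ≤ B₁ ∧ (∀ m ≤ i₁ + 1, 0 < rho t s m) ∧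
          rho t s (i₁ + 1) ≤ rho t s i₁ ∧ |(A₁ : ℤ) * ev t s i₁ + (B₁ : ℤ) * ev t s (i₁ + 1)| ≤ h ∧
          rho t s (i₁ + 1) * 2 ^ (p + p' + 1) ≤ h ∧ rho t s i₁ * 2 ^ p ≤ h ∧
          ∃ N, i₁ = i + (N + 1) ∧ A = A₁ * cfL t s i (N + 1) + B₁ * cfL t s i (N + 2) ∧
            B = A₁ * cfR t s i (N + 1) + B₁ * cfR t s i (N + 2) ∧ 6 * h < cost t s i (N + 3))) := by
  classical
  have hh : 1 ≤ h := by omega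
  have hρi : rho t s i ≤ h := le_trans (Nat.le_mul_of_pos_right _ (Nat.two_pow_pos p')) hp'
  have hρi1 : rho t s (i + 1) ≤ h := le_trans (Nat.le_mul_of_pos_right _ (Nat.two_pow_pos p)) hp
  -- the farthest affordable type with positive remainders on the way
  have good1 : (∀ m ≤ 1, cost t s i m ≤ 6 * h) ∧ (∀ m ≤ 1, 0 < rho t s (i + m)) := by
    refine ⟨fun m hm => ?_, fun m hm => hpos (i + m) (by omega)⟩
    interval_cases m
    · rw [cost_zero]; omega
    · rw [cost_one]; omega
  obtain ⟨n', hn'1, hn'le, hgood, hmax⟩ := exists_greatest_of_base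
    (fun n => (∀ m ≤ n, cost t s i m ≤ 6 * h) ∧ (∀ m ≤ n, 0 < rho t s (i + m)))
    (show 1 ≤ rho t s (i + 1) + 2 by omega) good1
  have hnot : ¬ ((∀ m ≤ n' + 1, cost t s i m ≤ 6 * h) ∧ (∀ m ≤ n' + 1, 0 < rho t s (i + m))) := by
    rcases hmax with hEq | ⟨-, hnot⟩
    · exfalso
      refine not_all_pos t s (j := i + 1) (by omega) fun m hm => ?_
      have := hgood.2 (m + 1) (by omega); rwa [show i + (m + 1) = i + 1 + m by omega] at this
    · exact hnot
  have hc2 : cost t s i 2 ≤ 6 * h := by have := cost_two_le (t := t) (s := s) i; omega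
  by_cases hc : cost t s i (n' + 1) ≤ 6 * h
  · -- target = the zero type τ_{i+n'+1}
    obtain ⟨K, hK⟩ : ∃ K, n' = K + 1 := ⟨n' - 1, by omega⟩
    have hF1 : ∀ m ≤ K + 2, cost t s i m ≤ 6 * h := fun m hm => by
      by_cases hmn : m ≤ n'
      · exact hgood.1 m hmn
      · rw [show m = n' + 1 by omega]; exact hc
    refine round_core hh K hpos hdec hbal hp hp' hF1 (Or.inl ?_)
    by_contra hne
    refine hnot ⟨fun m hm => hF1 m (by omega), fun m hm => ?_⟩
    by_cases hmn : m ≤ n'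
    · exact hgood.2 m hmn
    · rw [show m = K + 2 by omega]; exact Nat.pos_of_ne_zero hne
  · -- target = τ_{i+n'}, the next type is unaffordable
    have hn'2 : 2 ≤ n' := by
      by_contra hlt
      have h1 : n' = 1 := by omega
      rw [h1] at hc; exact hc hc2
    obtain ⟨K, hK⟩ : ∃ K, n' = K + 2 := ⟨n' - 2, by omega⟩
    refine round_core hh K hpos hdec hbal hp hp' (fun m hm => hgood.1 m (by omega)) (Or.inr ⟨?_, fun m hm => ?_⟩)
    · rw [show K + 3 = n' + 1 by omega]; omega
    · exact hgood.2 m (by omega)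

end Builder

end Summit.ValiantsHypothesis.ValiantsHypothesis.Theorems.DepthWindow.TreeBias
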